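import Summits.HodgeConjecture.HodgeConjecture.Theorems.GenericDivisibilityGenericDivisibilityBoundedSNCWitnesses
import Literature.AlgebraicGeometry.Resolution.LogResolutionSmoothProjectiveSNC
import HarnessLib

/-!
# The SNC normal form of the heart of line `finite-level-bootstrap`, unconditionally
# (crux C2 `GenericDivisibilityBounded`, stmt-HodgeConjecture-18467)

Registered sub-goal `stub_levelCleanOfSNCWitnessesUnconditional` (lead c6). Sorry-free,
definition-free. As in the sibling file `…SNCWitnesses` (p169430), spelled inline: `X`, `X'` smooth
projective over `ℂ`, `z| = z|_{(X∖Z)(ℂ)}` the restriction `H^k(X(ℂ);ℤ) → H^k((X∖Z)(ℂ);ℤ)`;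
"`x ∈ GT(X)`" (generically torsion): `∃ Z` closed `≠ univ`, `∃ N ≥ 1`, `N • x| = 0`;
"`D'_Z(m, z)`": `∃ y`, `∃ M ≥ 1`, `M • (z|_{(X∖Z)(ℂ)} - m • y) = 0`; "`D'(m, z)`": `∃ Z` closed
`≠ univ`, `D'_Z(m, z)`; "level `ℓ^s` is CLEAN at `X`": `∀ z, D'(ℓ^s, z) → ∃ w, z - ℓ • w ∈ GT(X)`.

## The argument

The sibling `stub_levelCleanOfSNCWitnesses` proves: GRANTED log resolution of proper closed subsets
of smooth projective complex varieties — for `Z ⊊ X` closed there is `σ : X' → X` birational, `X'`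
smooth projective of the same dimension, and a simple-normal-crossing list `E` on `X'` with
`σ⁻¹(Z) = ⋃ supp E` — a level `ℓ^s` which is clean FOR SNC WITNESS SETS on every smooth projective
birational model of `X` is clean at `X`. That log-resolution hypothesis is a PROVED theorem of the
tree over any algebraically closed field of characteristic zero, in particular over `ℂ`:
`Literature.AlgebraicGeometry.Resolution.exists_isBirational_hasSNC_preimage_eq` (the bare
SNC-witness form of `exists_logResolution_isSmoothProjective_hasSNC`; Kollár 2007, Thm. 3.21, via the
tree's proved marked-ideal order reduction, Thm. 3.69/3.72, and Hartshorne II 7.16 (c) for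
projectivity). Discharging it gives the registered statement.

## Main results

* `stub_levelCleanOfSNCWitnessesUnconditional` — the registered signature, verbatim: the heart at
  `(ℓ, s)` on a smooth projective `2p`-fold `X` follows from its SNC-witness form on the smooth
  projective birational models of `X`, unconditionally.

References: [Kollar2007] Thm. 3.21 (p. 124), Thm. 3.69 (p. 150), 3.72 (p. 152); [Hartshorne1977]
II Prop. 7.16 (c); [FultonYoungTableaux1997] App. B §B.1 (5)–(7); [Fulton1998] Lemma 19.1.2.
-/

set_option linter.dupNamespace false

noncomputable section

namespace Summit.HodgeConjecture.HodgeConjecture.Theorems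

open CategoryTheory AlgebraicGeometry
open Literature.AlgebraicGeometry.Motives Literature.AlgebraicGeometry.HodgeTheory
  Literature.AlgebraicTopology.SingularHomology

/-! ### The registered sub-goal -/

/-- **Registered sub-goal `stub_levelCleanOfSNCWitnessesUnconditional` of stmt-HodgeConjecture-18467
(lead c6, line `finite-level-bootstrap`): the SNC normal form of the heart, unconditionally.** Level
`ℓ^s` is clean at the smooth projective `2p`-fold `X` (`p ≥ 1`) as soon as it is clean FOR SNC
WITNESS SETS `⋃ supp E ≠ X'` on every smooth projective birational model `σ : X' ⟶ X`: given
`D'_Z(ℓ^s, z)` with `Z` closed `≠ X`, log-resolve `Z` — `σ : X' → X` birational from a smooth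
projective `X'` of dimension `2p` with `σ⁻¹Z = ⋃ supp E`, `E` a simple-normal-crossing list
(`Resolution.exists_isBirational_hasSNC_preimage_eq`, Kollár 2007 Thm. 3.21, PROVED in the tree over
the algebraically closed characteristic-zero field `ℂ`) — and conclude by the sibling
`stub_levelCleanOfSNCWitnesses` (p169430: pull back, apply the hypothesis off the SNC witness set
`σ⁻¹Z ≠ X'`, push forward by the integral Gysin map of degree one). Statement: the skeleton's,
verbatim.
[cite: Kollar2007, Thm. 3.21 (p. 124)] [cite: Hartshorne1977, II Prop. 7.16 (c)]
[cite: FultonYoungTableaux1997, Appendix B §B.1 (5)–(7)] -/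
theorem stub_levelCleanOfSNCWitnessesUnconditional :
    ∀ ⦃p : ℕ⦄ ⦃X : SchemeOver ℂ⦄, 1 ≤ p → IsSmoothProjective (2 * p) X → ∀ ℓ s : ℕ,
      (∀ (X' : SchemeOver ℂ) (σ : X' ⟶ X) (E : List X'.left.IdealSheafData),
        IsSmoothProjective (2 * p) X' → Literature.AlgebraicGeometry.Resolution.IsBirational σ.left →
        Literature.AlgebraicGeometry.Resolution.HasSNC E →
        (⋃ D ∈ E, ((D.support : Set X'.left))) ≠ Set.univ →
        ∀ z' : singularCohomology ℤ ℤ (ComplexPoints X') (2 * p),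
          (∃ (y : singularCohomology ℤ ℤ (complexPointsCompl X' (⋃ D ∈ E, ((D.support : Set X'.left)))) (2 * p))
              (M : ℕ), 1 ≤ M ∧
            M • (singularCohomology.map ℤ ℤ
              (⟨Subtype.val, continuous_subtype_val⟩ :
                C(complexPointsCompl X' (⋃ D ∈ E, ((D.support : Set X'.left))), ComplexPoints X'))
              (2 * p) z' - ℓ ^ s • y) = 0) →
          ∃ w : singularCohomology ℤ ℤ (ComplexPoints X') (2 * p),
            ∃ Z' : Set X'.left, IsClosed Z' ∧ Z' ≠ Set.univ ∧ ∃ N : ℕ, 1 ≤ N ∧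
              N • singularCohomology.map ℤ ℤ
                (⟨Subtype.val, continuous_subtype_val⟩ : C(complexPointsCompl X' Z', ComplexPoints X'))
                (2 * p) (z' - ℓ • w) = 0) →
      ∀ z : singularCohomology ℤ ℤ (ComplexPoints X) (2 * p),
        (∃ Z : Set X.left, IsClosed Z ∧ Z ≠ Set.univ ∧
          ∃ (y : singularCohomology ℤ ℤ (complexPointsCompl X Z) (2 * p)) (M : ℕ), 1 ≤ M ∧
            M • (singularCohomology.map ℤ ℤ
              (⟨Subtype.val, continuous_subtype_val⟩ : C(complexPointsCompl X Z, ComplexPoints X))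
              (2 * p) z - ℓ ^ s • y) = 0) →
        ∃ w : singularCohomology ℤ ℤ (ComplexPoints X) (2 * p),
          ∃ Z : Set X.left, IsClosed Z ∧ Z ≠ Set.univ ∧ ∃ N : ℕ, 1 ≤ N ∧
            N • singularCohomology.map ℤ ℤ
              (⟨Subtype.val, continuous_subtype_val⟩ : C(complexPointsCompl X Z, ComplexPoints X))
              (2 * p) (z - ℓ • w) = 0 :=
  stub_levelCleanOfSNCWitnesses
    Literature.AlgebraicGeometry.Resolution.exists_isBirational_hasSNC_preimage_eq

end Summit.HodgeConjecture.HodgeConjecture.Theorems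

end
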